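import Summits.CriticalPhenomena.CardyFormulaZ2.Theses.CardyQContinuation
import Literature.Probability.LatticeModels.FKIsingQuadrilateralCrossing

/-!
# Crux `IsingJetsConformal`, stub `stub_loopSymmetricLimit_fkIsingCrossingFunction_props`:
# elementary properties of the Chelkak–Smirnov crossing function
# (route `CardyQContinuation`, item stmt-CriticalPhenomena-5560, bridge lemma A3)

The Chelkak–Smirnov crossing function
`p(u) = A(u) / (B(u) + A(u))`, `A(u) = √(1 - √(1 - u))`, `B(u) = √(1 - √u)`
(`Literature.Probability.LatticeModels.fkIsingCrossingFunction`, total on `ℝ` with `Real.sqrt`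
vanishing on negatives) is the scaling limit of the critical FK-Ising crossing probability of a
quadrilateral of cross-ratio `u` (Chelkak–Smirnov 2012, Thm. 6.1). The `n = 0` bridge of the crux
squeezes the tree's discretisation between such quadrilaterals and needs exactly:

* `p` is continuous on `ℝ` (the denominator `B(u) + A(u)` never vanishes: `B(u) = 0 ↔ 1 ≤ u`,
  `A(u) = 0 ↔ u ≤ 0`);
* `p(0) = 0`, `p(1) = 1`;
* the self-duality `p(1 - u) = 1 - p(u)` for every real `u` (`A(1 - u) = B(u)`,
  `B(1 - u) = A(u)`, Rem. 6.2 of loc. cit.);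
* `p` is strictly increasing on `[0, 1]` (`A` increases, `B` decreases, and
  `A_u / (B_u + A_u) < A_v / (B_v + A_v) ↔ A_u B_v < A_v B_u`).

Everything is elementary real analysis of `Real.sqrt`; no named fact is used.

References: D. Chelkak, S. Smirnov, *Universality in the 2D Ising model and conformal invariance
of fermionic observables*, Invent. Math. 189 (2012), Thm. 6.1 eq. (6.1) and Rem. 6.2.
-/

namespace Summit.CriticalPhenomena.CardyFormulaZ2.Theorems.CardyQContinuation

open Set
open Literature.Probability.LatticeModels

noncomputable section

namespace FkIsingCrossingFunctionProps

/-- For `0 < u` the numerator `A(u) = √(1 - √(1 - u))` of the Chelkak–Smirnov crossing function is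
positive (`√(1 - u) < 1`). [folklore] -/
theorem fkIsingCrossingFunction_num_pos {u : ℝ} (hu : 0 < u) :
    0 < Real.sqrt (1 - Real.sqrt (1 - u)) := by
  have h : Real.sqrt (1 - u) < 1 := (Real.sqrt_lt' one_pos).2 (by rw [one_pow]; linarith)
  exact Real.sqrt_pos.2 (by linarith)

/-- For `u < 1` the dual numerator `B(u) = √(1 - √u)` of the Chelkak–Smirnov crossing function is
positive (`√u < 1`). [folklore] -/
theorem fkIsingCrossingFunction_dualNum_pos {u : ℝ} (hu : u < 1) :
    0 < Real.sqrt (1 - Real.sqrt u) := by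
  have h : Real.sqrt u < 1 := (Real.sqrt_lt' one_pos).2 (by rw [one_pow]; linarith)
  exact Real.sqrt_pos.2 (by linarith)

/-- The denominator `B(u) + A(u) = √(1 - √u) + √(1 - √(1 - u))` of the Chelkak–Smirnov crossing
function is positive for EVERY real `u`: `B(u) > 0` unless `1 ≤ u`, `A(u) > 0` unless `u ≤ 0`.
[folklore] -/
theorem fkIsingCrossingFunction_den_pos (u : ℝ) :
    0 < Real.sqrt (1 - Real.sqrt u) + Real.sqrt (1 - Real.sqrt (1 - u)) := by
  rcases lt_or_ge 0 u with hu | hu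
  · exact add_pos_of_nonneg_of_pos (Real.sqrt_nonneg _) (fkIsingCrossingFunction_num_pos hu)
  · exact add_pos_of_pos_of_nonneg (fkIsingCrossingFunction_dualNum_pos (hu.trans_lt one_pos))
      (Real.sqrt_nonneg _)

/-- The Chelkak–Smirnov crossing function is continuous on `ℝ` (a quotient of continuous functions
with nowhere-vanishing denominator). [folklore] -/
theorem fkIsingCrossingFunction_continuous : Continuous fkIsingCrossingFunction := by
  unfold fkIsingCrossingFunction
  exact Continuous.div (by fun_prop) (by fun_prop) fun u ↦ (fkIsingCrossingFunction_den_pos u).ne'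

/-- `p(0) = 0`: the numerator `A(0) = √(1 - √1)` vanishes. [folklore] -/
theorem fkIsingCrossingFunction_zero : fkIsingCrossingFunction 0 = 0 := by
  simp [fkIsingCrossingFunction]

/-- `p(1) = 1`: `A(1) = 1` and `B(1) = 0`. [folklore] -/
theorem fkIsingCrossingFunction_one : fkIsingCrossingFunction 1 = 1 := by
  simp [fkIsingCrossingFunction]

/-- **Self-duality** `p(1 - u) = 1 - p(u)` for every real `u`: `A(1 - u) = B(u)` and
`B(1 - u) = A(u)`, so `p(1 - u) = B / (A + B) = 1 - A / (B + A)`.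
[cite: ChelkakSmirnov2012Ising, Rem. 6.2] -/
theorem fkIsingCrossingFunction_one_sub (u : ℝ) :
    fkIsingCrossingFunction (1 - u) = 1 - fkIsingCrossingFunction u := by
  have hD := (fkIsingCrossingFunction_den_pos u).ne'
  rw [eq_sub_iff_add_eq]
  unfold fkIsingCrossingFunction
  rw [sub_sub_cancel, add_comm (Real.sqrt (1 - Real.sqrt (1 - u))) (Real.sqrt (1 - Real.sqrt u)),
    ← add_div, div_self hD]

/-- **Strict monotonicity on `[0, 1]`.** For `0 ≤ u < v ≤ 1`: `A(u) < A(v)`, `B(v) < B(u)`,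
`B(u) > 0`, and cross-multiplying the positive denominators reduces
`A_u / (B_u + A_u) < A_v / (B_v + A_v)` to `A_u B_v < A_v B_u`, which follows from
`A_u B_v ≤ A_u B_u < A_v B_u`. [folklore] -/
theorem fkIsingCrossingFunction_strictMonoOn :
    StrictMonoOn fkIsingCrossingFunction (Icc (0 : ℝ) 1) := by
  rintro u ⟨hu0, hu1⟩ v ⟨hv0, hv1⟩ huv
  have hA : Real.sqrt (1 - Real.sqrt (1 - u)) < Real.sqrt (1 - Real.sqrt (1 - v)) := by
    have h1 : Real.sqrt (1 - v) < Real.sqrt (1 - u) := Real.sqrt_lt_sqrt (by linarith) (by linarith)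
    have h2 : Real.sqrt (1 - u) ≤ 1 := Real.sqrt_le_one.2 (by linarith)
    exact Real.sqrt_lt_sqrt (by linarith) (by linarith)
  have hB : Real.sqrt (1 - Real.sqrt v) < Real.sqrt (1 - Real.sqrt u) := by
    have h1 : Real.sqrt u < Real.sqrt v := Real.sqrt_lt_sqrt hu0 huv
    have h2 : Real.sqrt v ≤ 1 := Real.sqrt_le_one.2 hv1
    exact Real.sqrt_lt_sqrt (by linarith) (by linarith)
  have hAu : 0 ≤ Real.sqrt (1 - Real.sqrt (1 - u)) := Real.sqrt_nonneg _
  have hBv : 0 ≤ Real.sqrt (1 - Real.sqrt v) := Real.sqrt_nonneg _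
  have hBu : 0 < Real.sqrt (1 - Real.sqrt u) :=
    fkIsingCrossingFunction_dualNum_pos (huv.trans_le hv1)
  have hAv : 0 < Real.sqrt (1 - Real.sqrt (1 - v)) :=
    fkIsingCrossingFunction_num_pos (hu0.trans_lt huv)
  unfold fkIsingCrossingFunction
  rw [div_lt_div_iff₀ (by positivity) (by positivity)]
  nlinarith [mul_le_mul_of_nonneg_left hB.le hAu, mul_lt_mul_of_pos_right hA hBu]

end FkIsingCrossingFunctionProps

open FkIsingCrossingFunctionProps

/-- **Stub `stub_loopSymmetricLimit_fkIsingCrossingFunction_props` (bridge lemma A3)** of the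
skeleton of the crux `IsingJetsConformal` (stmt-CriticalPhenomena-5560): the Chelkak–Smirnov
crossing function `p(u) = √(1 - √(1 - u)) / (√(1 - √u) + √(1 - √(1 - u)))`
(`Literature.Probability.LatticeModels.fkIsingCrossingFunction`) is continuous on `ℝ`, satisfies
`p(0) = 0`, `p(1) = 1`, the self-duality `p(1 - u) = 1 - p(u)` for every real `u`, and is
strictly increasing on `[0, 1]`. [cite: ChelkakSmirnov2012Ising, Thm. 6.1 eq. (6.1), Rem. 6.2] -/
theorem stub_loopSymmetricLimit_fkIsingCrossingFunction_props : (Continuous Literature.Probability.LatticeModels.fkIsingCrossingFunction ∧ Literature.Probability.LatticeModels.fkIsingCrossingFunction 0 = 0 ∧ Literature.Probability.LatticeModels.fkIsingCrossingFunction 1 = 1 ∧ (∀ u : ℝ, Literature.Probability.LatticeModels.fkIsingCrossingFunction (1 - u) = 1 - Literature.Probability.LatticeModels.fkIsingCrossingFunction u) ∧ StrictMonoOn Literature.Probability.LatticeModels.fkIsingCrossingFunction (Set.Icc (0:ℝ) 1)) :=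
  ⟨fkIsingCrossingFunction_continuous, fkIsingCrossingFunction_zero, fkIsingCrossingFunction_one,
    fkIsingCrossingFunction_one_sub, fkIsingCrossingFunction_strictMonoOn⟩

end

end Summit.CriticalPhenomena.CardyFormulaZ2.Theorems.CardyQContinuation
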